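import Mathlib
import Summits.Ventures.HodgeRepro2.T5AdicCompletionHenselian

/-!
# The principal units `U¹ = 1 + 𝔪_Kv` are `n`-divisible for `n` prime to `p`; characters of order
# prime to `p` are trivial on `U¹`

Hensel's lemma at a finite place (`T5AdicCompletionHenselian`) on `X^n − u`, `u ≡ 1 (mod 𝔪)`: the
root `1` modulo `𝔪` is simple when `n` is a unit of `O_Kv` (residue characteristic `∤ n`), so every
principal unit is an `n`-th power of a principal unit (`exists_pow_eq_of_principal`).  Hence a
character `χ` of `Kvˣ` (or of `O_Kvˣ`) with `χ^n = 1` and `p ∤ n` is trivial on `U¹`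
(`eq_one_of_pow_eq_one_of_principal`): the TAME characters of `O_Kv^×` are exactly the characters of
`O_Kv^× / U¹ ≅ k^×` — the (A3)(c) / (A10) bookkeeping of route/T5-route-2.md, with
`T5TeichmullerDecomposition` (`O_Kv^× = μ_{q−1} × U¹`).

Declaration per README §8(d): «uses an L-value-free non-vanishing device: NO».
-/

namespace Summit.Ventures.HodgeRepro2.T5PrincipalUnitsDivisible

open IsDedekindDomain HeightOneSpectrum IsLocalRing Polynomial

variable {K : Type*} [Field K] [NumberField K] (v : HeightOneSpectrum (NumberField.RingOfIntegers K))

/-- `U¹` IS `n`-DIVISIBLE for `n` a unit of `O_Kv`: every `u ≡ 1 (mod 𝔪)` is `w^n` with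
`w ≡ 1 (mod 𝔪)` (Hensel on `X^n − u` at the simple root `1`). -/
theorem exists_pow_eq_of_principal {n : ℕ} (hn : IsUnit (n : adicCompletionIntegers K v))
    {u : adicCompletionIntegers K v} (hu : u - 1 ∈ maximalIdeal (adicCompletionIntegers K v)) :
    ∃ w : adicCompletionIntegers K v, w - 1 ∈ maximalIdeal (adicCompletionIntegers K v) ∧ w ^ n = u := by
  have hn0 : n ≠ 0 := by
    rintro rfl
    simp at hn
  have hmonic : (X ^ n - C u).Monic := monic_X_pow_sub_C u hn0
  have h₁ : (X ^ n - C u).eval 1 ∈ maximalIdeal (adicCompletionIntegers K v) := by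
    rw [eval_sub, eval_pow, eval_X, eval_C, one_pow]
    have := (maximalIdeal (adicCompletionIntegers K v)).neg_mem hu
    rwa [neg_sub] at this
  have h₂ : IsUnit ((X ^ n - C u).derivative.eval 1) := by
    rw [derivative_sub, derivative_X_pow, derivative_C, sub_zero, eval_mul, eval_C, eval_pow, eval_X,
      one_pow, mul_one]
    exact hn
  obtain ⟨w, hroot, hw1⟩ := T5AdicCompletionHenselian.exists_isRoot_of_eval_mem_maximalIdeal v _ hmonic 1 h₁ h₂
  refine ⟨w, hw1, ?_⟩
  rw [IsRoot.def, eval_sub, eval_pow, eval_X, eval_C, sub_eq_zero] at hroot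
  exact hroot

/-- The unit form: a principal unit `u` (as a unit of `O_Kv` with residue `1`) is `w^n` for a
principal unit `w`. -/
theorem exists_units_pow_eq_of_residue_eq_one {n : ℕ} (hn : IsUnit (n : adicCompletionIntegers K v))
    (u : (adicCompletionIntegers K v)ˣ) (hu : residue (adicCompletionIntegers K v) (u : adicCompletionIntegers K v) = 1) :
    ∃ w : (adicCompletionIntegers K v)ˣ,
      residue (adicCompletionIntegers K v) (w : adicCompletionIntegers K v) = 1 ∧ w ^ n = u := by
  have hu' : (u : adicCompletionIntegers K v) - 1 ∈ maximalIdeal (adicCompletionIntegers K v) := by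
    rw [← residue_eq_zero_iff, map_sub, map_one, hu, sub_self]
  obtain ⟨w, hw1, hwn⟩ := exists_pow_eq_of_principal v hn hu'
  have hwu : IsUnit w := by
    rw [← residue_ne_zero_iff_isUnit]
    have : residue (adicCompletionIntegers K v) w = 1 := by
      rw [← sub_eq_zero, ← map_one (residue (adicCompletionIntegers K v)), ← map_sub, residue_eq_zero_iff]
      exact hw1
    rw [this]; exact one_ne_zero
  refine ⟨hwu.unit, ?_, ?_⟩
  · rw [IsUnit.unit_spec, ← sub_eq_zero, ← map_one (residue (adicCompletionIntegers K v)), ← map_sub,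
      residue_eq_zero_iff]
    exact hw1
  · apply Units.ext
    rw [Units.val_pow_eq_pow_val, IsUnit.unit_spec, hwn]

/-- A character of `O_Kvˣ` with `χ^n = 1`, `n` a unit of `O_Kv` (order prime to the residue
characteristic), is TRIVIAL ON THE PRINCIPAL UNITS `U¹`. -/
theorem eq_one_of_pow_eq_one_of_residue_eq_one {M : Type*} [CommGroup M]
    (χ : (adicCompletionIntegers K v)ˣ →* M) {n : ℕ} (hn : IsUnit (n : adicCompletionIntegers K v))
    (hχ : ∀ x, χ x ^ n = 1) (u : (adicCompletionIntegers K v)ˣ)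
    (hu : residue (adicCompletionIntegers K v) (u : adicCompletionIntegers K v) = 1) : χ u = 1 := by
  obtain ⟨w, -, rfl⟩ := exists_units_pow_eq_of_residue_eq_one v hn u hu
  rw [map_pow]
  exact hχ w

end Summit.Ventures.HodgeRepro2.T5PrincipalUnitsDivisible
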